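import Summits.BirchSwinnertonDyer.BirchSwinnertonDyer.Theses.UniversalToricDescent
import Summits.BirchSwinnertonDyer.BirchSwinnertonDyer.Theorems.UniversalToricDescentTwinK2ResOfConclusion
import Summits.BirchSwinnertonDyer.BirchSwinnertonDyer.Theorems.UniversalToricDescentPrincipalHeegnerIndivisibleDefs
import Summits.BirchSwinnertonDyer.BirchSwinnertonDyer.Theorems.UniversalToricDescentTwinAlgMuZeroAtThreeStubThm161
import Summits.BirchSwinnertonDyer.BirchSwinnertonDyer.Theorems.UniversalToricDescentTwinKsTwinOfSource
import Summits.BirchSwinnertonDyer.BirchSwinnertonDyer.Theorems.UniversalToricDescentKsTwinLambdaDefs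
import Summits.BirchSwinnertonDyer.BirchSwinnertonDyer.Theorems.UniversalToricDescentTwinCoherentHeegnerFamily
import Summits.BirchSwinnertonDyer.BirchSwinnertonDyer.Theorems.UniversalToricDescentTwinHowardConclusionOfKS
import Summits.BirchSwinnertonDyer.BirchSwinnertonDyer.Theorems.UniversalToricDescentHeegnerClassNotDivisible
import Literature.NumberTheory.EllipticCurves.LambdaAdicSelmerDataProofs
import Literature.NumberTheory.GaloisCohomology.Howard2004.DVRKolyvaginBoundPrintIntended
import Literature.NumberTheory.QuadraticFields.KroneckerSplitting
import Literature.NumberTheory.EllipticCurves.RingClassFieldTower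
import Literature.NumberTheory.EllipticCurves.IwasawaAlgebraSpecializationFiniteKernelSeparationProofs
import Summits.BirchSwinnertonDyer.BirchSwinnertonDyer.Theorems.UniversalToricDescentTwinAlgMuZeroAtThreeStubResidualLinkMult
import Summits.BirchSwinnertonDyer.BirchSwinnertonDyer.Theorems.UniversalToricDescentTowerNoPTorsion
import Summits.BirchSwinnertonDyer.BirchSwinnertonDyer.Theorems.UniversalToricDescentAcDualMuZeroCriterion
import Summits.BirchSwinnertonDyer.BirchSwinnertonDyer.Theorems.UniversalToricDescentStrictPlaceNoPTorsion
import Literature.NumberTheory.EllipticCurves.Castella2024.LambdaAdicHeegnerClassExistence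
import Literature.NumberTheory.EllipticCurves.HeegnerModuleIndex
import Literature.NumberTheory.EllipticCurves.IwasawaSelmer
import HarnessLib

/-!
# Crux r205 `TwinAlgMuZeroAtThree` (stmt-BirchSwinnertonDyer-24737), bucket B (très-ramifié multiplicative twin at `3`):
# the COMPOSITION of line `beta-road` as a sorry-free theorem — «K1″ ∧ K2a‴ ⟹ the crux's conclusion on bucket B»

Cell `pub/bsd-wall`, LEAD lineage `bsd-wall-utd-p1` (g29), 2026-08-30; `--supports stmt-BirchSwinnertonDyer-24737 --as helper`.
THEOREMS ONLY (no definition, no named fact, no instance, no `sorry`).  This is the registered skeleton `Lines/beta-road.lean` v16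
(sha16 `a84e0bb203085cb5`) of crux 24737 with its two bucket-B research stubs turned into HYPOTHESES BY NAME — the Theorems constants
`UniversalToricDescentPrincipalHeegnerIndivisibleDefs.PrincipalHeegnerIndivisibleMultAtThree` (K1″: a principal Heegner norm point of
conductor `3^{k+1}` is locally `3`-indivisible at `𝔭` over `K_k`; `@[conjecture]`, instrument-decidable per instance) and
`UniversalToricDescentKsTwinLambdaDefs.KsTwinLambdaAdicAtThree` (K2a‴: ONE `Λ`-adic Heegner-point Kolyvagin system on lit's
`shapiroSettingTame` with bottom class `Φ′(𝐳_∞)` — Howard 2004 Thm. 2.3.1 / CGLS 2022 Thm. 4.1.1 read at `p = 3 ∥ N′`; `@[conjecture]`,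
unprinted at `p ∣ N`) — so that «the line is CLOSED MODULO its research stubs» is a kernel-checked TREE fact rather than a sorried
Cruxes file, and so that the route pen may split 24737 into its stubs with a one-line glue from this module.  Every other input is a
landed theorem of the tree: the canonical norm-compatible Heegner family at `3 ∣ N′` and Kummer injectivity (`…TwinCoherentHeegnerFamily`,
p768860/p769367), the Manin-free KS link (`…TwinKsTwinOfSource`, p768903), the twin's `SatisfiesH` (p761918), Howard Thm. 1.6.1
print-as-intended F-161′ (`stub_thm161`, x9 cell), the bounded-index road to K2_res (`…TwinK2ResOfConclusion`, p766849), the residual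
two-sided link P_res (`stub_residualLinkMult`, p745706) and the receptacle `…AcDualMuZero.isTorsion_and_exists_generator_of_finite_pTorsion`.

CHAIN (bucket B): K1″(𝔭) ⟹ K1(𝔭) (coherent family + local Kummer currency) · `𝔭′` is of degree one (`3 ∣ N′`, Heegner) ⟹ K1″(𝔭′) ⟹ K1(𝔭′) ·
K2a‴ ⟹ KS-twin at every Eisenstein level (`ksTwin_of_ksTwinLambda`) ⟹ Howard's conclusion at the control levels
(`howardConclusionOfFamily_of_ksTwinLambda`) ⟹ K2_res `residualCorankLeOneMult_of_ksTwinLambda` ⟹ P_res ⟹ `X_(∅,0)(E′/K_∞)` at `𝔭′` is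
`Λ`-torsion with algebraic `μ = 0` (`twinAlgMuZeroAtThree_mult_of_betaRoad`).  The C₀ bucket (good supersingular, `a₃ = 0`) of the crux
enters only as the explicit hypothesis `hC0` of the last theorem `twinAlgMuZeroAtThree_of_betaRoadStubs` (= the skeleton's `TwinAlgMuZeroAtThree_of`
with its three `sorry`s replaced by hypotheses: K1″, K2a‴ BY NAME, C₀ `stub_goodSS` VERBATIM), which concludes the crux BY NAME.

HONEST FRAMING: a CONDITIONAL theorem — both hypotheses are open research statements (obligation nodes, never benched as print); nothing
is discharged; crux 24737 stays OPEN; the Birch–Swinnerton-Dyer conjecture is proved for no curve by this file.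
References: [Howard2004HeegnerKolyvagin] Thm. 1.6.1, Thm. 2.3.1, §2.2–2.3, Thm. B; [CastellaGrossiLeeSkinner2022] Thm. 4.1.1, Rem. 4.1.4;
[BertoliniDarmon1996] §2.5; [GreenbergLNM1716] §1; [PerrinRiou1987BSMF] §3.
-/

noncomputable section

open scoped Classical Pointwise ContRepresentation TensorProduct NumberField

set_option linter.dupNamespace false -- `…BirchSwinnertonDyer.BirchSwinnertonDyer…` is the cell's nested layout (D-0017)
set_option autoImplicit false

namespace Summit.BirchSwinnertonDyer.BirchSwinnertonDyer.Theorems.UniversalToricDescentTwinAlgMuZeroAtThreeOfBetaRoad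

open NumberField IsDedekindDomain Field WeierstrassCurve
open Literature.NumberTheory.EllipticCurves Literature.NumberTheory.EllipticCurves.GreenbergSelmer
  Literature.NumberTheory.EllipticCurves.IwasawaAlgebra
open Summit.BirchSwinnertonDyer.Rank1Residual.X11b Summit.BirchSwinnertonDyer.Rank1Residual.X11b.AcSelmer
open Summit.BirchSwinnertonDyer.BirchSwinnertonDyer.Theorems.UniversalToricDescentAcDualMuZero
open Summit.BirchSwinnertonDyer.BirchSwinnertonDyer.Theorems.UniversalToricDescentHeegnerClassNotDivisible
open Summit.BirchSwinnertonDyer.BirchSwinnertonDyer.Theorems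
open Literature Literature.NumberTheory.GaloisCohomology Literature.NumberTheory.GaloisCohomology.Howard2004
open Literature.NumberTheory.Automorphic Literature.NumberTheory.GaloisRepresentations
  Literature.NumberTheory.GaloisRepresentations.DiscreteGaloisModule
open Literature.NumberTheory.EllipticCurves.ZpExtension Literature.NumberTheory.EllipticCurves.CastellaGrossiLeeSkinner2022
open Summit.BirchSwinnertonDyer.BirchSwinnertonDyer.Theorems.UniversalToricDescentTowerTorsion
open Literature.NumberTheory.EllipticCurves.Castella2024 Literature.NumberTheory.EllipticCurves.IwasawaAlgebra
  Summit.BirchSwinnertonDyer.BirchSwinnertonDyer.Theorems.UniversalToricDescentStrictPlace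
open Literature.NumberTheory.EllipticCurves.ModularForms (ModularParametrizationData heegnerPointComplexOfConductor)

/-! ## 1. K1 from K1″ -/

/-- **K1 of line `beta-road` (`stub_coherentBetaMult` of v3–v15) from K1″ BY NAME**: at every degree-one `𝔭 ∋ 3`, a norm-coherent
Heegner family `F` of the twin (sign `α`, `α² = 1`) with a layer `k` whose norm point has NON-ZERO local Kummer class on
`Γ_{K_k} ∩ D_𝔭` on every third root — the CANONICAL family through K1″'s witness (`anticyclotomicTowerSharp` + the `U_3`-relation of
the principal Heegner points at `3 ∣ N′`, `α = a_3(E′) = ±1`; `…TwinCoherentHeegnerFamily.twin_coherentBeta_of_principalNotDivisible`)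
and Kummer injectivity. [cite: BertoliniDarmon1996, §2.5 eq. (7)] [cite: Howard2004HeegnerKolyvagin, §3.3] [cite: PerrinRiou1987BSMF, §3.2–3.3] -/
theorem coherentBetaMult_of_principalIndivisible
    (hK1 : UniversalToricDescentPrincipalHeegnerIndivisibleDefs.PrincipalHeegnerIndivisibleMultAtThree) :
    ∀ (W' : WeierstrassCurve ℚ) [W'.IsElliptic] [W'.IsGloballyMinimal] (N' : ℕ) [NeZero N']
      (K : Type) [Field K] [NumberField K],
      Rank1Residual.Mult W' 3 → ¬ 3 ∣ padicValInt 3 W'.minimalDiscriminantInt →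
      W'.HasSurjectiveModNGaloisRep 3 → W'.conductorNorm ℤ = N' → IsImaginaryQuadratic K →
      SatisfiesHeegnerHypothesis N' K → Odd (NumberField.discr K) →
      ∀ (κ : ZpExtension K 3), κ.IsAnticyclotomic →
      ∀ (γ : absoluteGaloisGroup K) [Fact (κ.IsTopGenerator γ)]
        (𝔭 : HeightOneSpectrum (𝓞 K)), ((3 : ℕ) : 𝓞 K) ∈ 𝔭.asIdeal →
        𝔭.asIdeal.ramificationIdx (𝓞 ℚ) = 1 → 𝔭.asIdeal.inertiaDeg (𝓞 ℚ) = 1 →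
      ∃ (jbar : AlgebraicClosure K →+* ℂ) (F : HeegnerFamily N' W' K κ jbar) (α : ℤ),
        α ^ 2 = 1 ∧ F.IsNormCompatible γ α ∧
        (∃ k : ℕ, ∀ (Q : geomPoints (W'.baseChange K))
          (hQ : ∀ σ ∈ κ.layerSubgroup k ⊓ decomp 𝔭, σ • ((3 : ℤ) • Q) = (3 : ℤ) • Q),
          (3 : ℤ) • Q = F.z k →
            (W'.baseChange K).kummerClassOver (κ.layerSubgroup k ⊓ decomp 𝔭) 3 Q hQ ≠ 0) := by
  intro W' _ _ N' _ K _ _ hm htr hsurj hN hK hH hodd κ hκ γ _ 𝔭 h𝔭 he hf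
  obtain ⟨jbar, Dt, β, hβ, k, x, R, hx, hRsub, htrans, hndiv⟩ :=
    (UniversalToricDescentPrincipalHeegnerIndivisibleDefs.principalHeegnerIndivisibleMultAtThree_iff.mp hK1) W' N' K hm htr hsurj hN hK hH hodd κ hκ 𝔭 h𝔭 he hf
  obtain ⟨F, α, -, hα, hcoh, hk⟩ :=
    Summit.BirchSwinnertonDyer.BirchSwinnertonDyer.Theorems.UniversalToricDescentTwinCoherentHeegnerFamily.twin_coherentBeta_of_principalNotDivisible
      W' N' K hm hN hK κ hκ γ
      (decomp 𝔭) jbar Dt β hβ k x R hx hRsub htrans hndiv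
  exact ⟨jbar, F, α, hα, hcoh, hk⟩

/-! ## 2. The KS-twin at every Eisenstein level from K2a‴ -/

/-- **The KS-twin (`stub_ksTwin` of v13/v14) from K2a‴ BY NAME**: for the levels-tame Eisenstein settings at `q_m = T^m + 3`, `m ≫ 0`,
Kolyvagin systems with `κ₁ ≠ 0` and the link `κ₁ k = I.proj (k+1) (f_m z)` — x9's pushforward of the ONE `Λ`-adic source Kolyvagin
system along THE `Hom` (`WeierstrassCurve.twin_ksTwin_of_source`, Manin-free, p768903).
[cite: Howard2004HeegnerKolyvagin, §1.3, §1.7, §2.3, Thm. 2.3.1] [cite: CastellaGrossiLeeSkinner2022, Thm. 4.1.1, §3.4] -/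
theorem ksTwin_of_ksTwinLambda (hK2 : UniversalToricDescentKsTwinLambdaDefs.KsTwinLambdaAdicAtThree) :
    ∀ (W' : WeierstrassCurve ℚ) [W'.IsElliptic] [W'.IsGloballyMinimal] (N' : ℕ) [NeZero N']
      (K : Type) [Field K] [NumberField K],
      Rank1Residual.Mult W' 3 → ¬ 3 ∣ padicValInt 3 W'.minimalDiscriminantInt →
      ∀ (hsurj : W'.HasSurjectiveModNGaloisRep 3), W'.conductorNorm ℤ = N' → ∀ (hK : IsImaginaryQuadratic K),
      SatisfiesHeegnerHypothesis N' K → Odd (NumberField.discr K) →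
      ∀ (κ : ZpExtension K 3), κ.IsAnticyclotomic →
      ∀ (γ : absoluteGaloisGroup K) [hγ : Fact (κ.IsTopGenerator γ)]
        (jbar : AlgebraicClosure K →+* ℂ) (F : HeegnerFamily N' W' K κ jbar) (α : ℤ),
        α ^ 2 = 1 → F.IsNormCompatible γ α →
      ∀ (Dat : (W'.baseChange K).LambdaAdicSelmerData κ γ) (z : Dat.S),
        IsLambdaAdicHeegnerClass Dat F α z → z ≠ 0 →
      ∃ (S : Finset (HeightOneSpectrum (𝓞 K)))
        (hpS : ∀ v, ((3 : ℕ) : 𝓞 K) ∈ v.asIdeal → v ∈ S)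
        (hbad : ∀ v, v ∉ S → ((3 : ℕ) : 𝓞 K) ∉ v.asIdeal → (W'.baseChange K).HasGoodReductionAt v)
        (_hSN : ∀ v ∈ S, ((3 : ℕ) : 𝓞 K) ∈ v.asIdeal ∨ ((N' : ℕ) : 𝓞 K) ∈ v.asIdeal)
        (_hSσ : ∀ (σ : K ≃ₐ[ℚ] K) (v : HeightOneSpectrum (𝓞 K)), σ • v ∈ S → v ∈ S)
        (m₁ : ℕ), ∀ (m : ℕ) (hm : 1 ≤ m), m₁ ≤ m →
        letI := IwasawaAlgebra.isDomain_quotient_X_pow_add_C 3 hm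
        letI := IwasawaAlgebra.isDiscreteValuationRing_quotient_X_pow_add_C 3 hm
        haveI := IwasawaAlgebra.EisensteinCoeff.isLocalRing_succ 3 hm
        letI := IwasawaAlgebra.EisensteinCoeff.algebraOfSpecSucc 3 m
        haveI := W'.isScalarTower_algebraOfSpecSucc (K := K) (p := 3) (m := m)
        letI := W'.residueModuleSucc (K := K) (p := 3) hm
        ∃ (π : ∀ v : HeightOneSpectrum (𝓞 K), TamePin v) (L : Set (HeightOneSpectrum (𝓞 K)))
          (hL : L ⊆ (W'.eisensteinTower (κ.unitTwist (-1)) hm).degreeTwoPrimes 3) (hLS : ∀ v ∈ L, v ∉ S)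
          (s₁ : ℕ) (_hsub : ∀ v ∈ (W'.eisensteinTower (κ.unitTwist (-1)) hm).kolyvaginPrimes 3 s₁, v ∉ S → v ∈ L)
          (t : ∀ k, ((W'.baseChange K).torsionGaloisModule (((3 : ℕ) : ℤ) ^ (k + 1))).toContRepresentation →ⁱL
            ((W'.baseChange K).torsionGaloisModule (((3 : ℕ) : ℤ) ^ k)).toContRepresentation)
          (ht : ∀ k (P : geomTorsion (W'.baseChange K) (((3 : ℕ) : ℤ) ^ (k + 1))),
            t k P = (W'.baseChange K).geomTorsionReduce 3 k P)
          (I : ZpExtension.EisensteinH1Data (κ.unitTwist (-1))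
            (fun k ↦ (W'.baseChange K).torsionGaloisModule (((3 : ℕ) : ℤ) ^ k)) t hm)
          (jbar' : AlgebraicClosure K →+* ℂ),
          ∀ (cd : ConjugationDatum K)
            (Dd : ∀ k, DualityDatum 3 cd ((W'.eisensteinTower (κ.unitTwist (-1)) hm).ρ k)
              (IwasawaAlgebra.EisensteinCoeff 3 m (k + 1)))
            (hy : (W'.eisensteinDVRSettingLevelsTame (κ.unitTwist (-1)) hm π S hpS hbad L hL hLS jbar' cd Dd).SatisfiesH),
            ∃ κKS : (W'.eisensteinDVRSettingLevelsTame (κ.unitTwist (-1)) hm π S hpS hbad L hL hLS jbar' cd Dd).KolyvaginSystem,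
              κKS.one ≠ 0 ∧
              ∀ k, κKS.one k = I.proj (k + 1) (Dat.toEisensteinH1Linear hm t ht I hγ.out (baseChange_noPTorsion_of_surjective W' 3 hsurj K hK) z)
 := by
  intro W' _ _ N' _ K _ _ hm htr hsurj hN hK hH hodd κ hκ γ hγ jbar F α hα hcoh Dat z hz hz0
  exact WeierstrassCurve.twin_ksTwin_of_source W' N' K hsurj hN hK hH κ hκ γ jbar Dat z hz0
    ((UniversalToricDescentKsTwinLambdaDefs.ksTwinLambdaAdicAtThree_iff.mp hK2) W' N' K hm htr hsurj hN hK hH hodd κ hκ γ jbar F α hα hcoh Dat z hz hz0)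

/-! ## 3. Howard's conclusion at the control levels, and K2_res -/

set_option synthInstance.maxHeartbeats 80000 in
set_option maxHeartbeats 1600000 in
/-- **Howard's conclusion at the control levels of the `Λ`-adic Heegner class (`stub_howardConclusionOfFamily` of v12) from K2a‴ BY
NAME + K1's local currency**: the datum `Dat` exists (Perrin-Riou), the `Λ`-adic Heegner class `z` of `F` exists (Bertolini–Darmon),
`z ≠ 0` by K1 + `not_exists_eq_natCast_smul_of_layerIndivisible`, and the conclusion is x9's D1 chain on the twin frame: the KS-twin (§2),
the twin's `SatisfiesH` (p761918), `LargePrimes` (generic), Howard Thm. 1.6.1 print-as-intended (`stub_thm161`, landed; its guards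
`3 ≠ 0 ∈ S_m` and `3 ∤ #𝓞_K^×` discharged here: `3` splits ⟹ `d_K ≠ −3`, odd `d_K` ⟹ `d_K < −4`).
[cite: Howard2004HeegnerKolyvagin, §1.3, Thm. 1.6.1, §1.7, §2.3, Prop. 2.2.8] [cite: BertoliniDarmon1996, §2.5] -/
theorem howardConclusionOfFamily_of_ksTwinLambda (hK2 : UniversalToricDescentKsTwinLambdaDefs.KsTwinLambdaAdicAtThree) :
    ∀ (W' : WeierstrassCurve ℚ) [W'.IsElliptic] [W'.IsGloballyMinimal] (N' : ℕ) [NeZero N']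
      (K : Type) [Field K] [NumberField K],
      Rank1Residual.Mult W' 3 → ¬ 3 ∣ padicValInt 3 W'.minimalDiscriminantInt →
      ∀ (hsurj : W'.HasSurjectiveModNGaloisRep 3), W'.conductorNorm ℤ = N' → ∀ (hK : IsImaginaryQuadratic K),
      SatisfiesHeegnerHypothesis N' K → Odd (NumberField.discr K) →
      ∀ (κ : ZpExtension K 3), κ.IsAnticyclotomic →
      ∀ (γ : absoluteGaloisGroup K) [hγ : Fact (κ.IsTopGenerator γ)]
        (𝔭 : HeightOneSpectrum (𝓞 K)), ((3 : ℕ) : 𝓞 K) ∈ 𝔭.asIdeal →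
        𝔭.asIdeal.ramificationIdx (𝓞 ℚ) = 1 → 𝔭.asIdeal.inertiaDeg (𝓞 ℚ) = 1 →
      ∀ (jbar : AlgebraicClosure K →+* ℂ) (F : HeegnerFamily N' W' K κ jbar) (α : ℤ),
        α ^ 2 = 1 → F.IsNormCompatible γ α →
        (∃ k : ℕ, ∀ (Q : geomPoints (W'.baseChange K))
          (hQ : ∀ σ ∈ κ.layerSubgroup k ⊓ decomp 𝔭, σ • ((3 : ℤ) • Q) = (3 : ℤ) • Q),
          (3 : ℤ) • Q = F.z k →
            (W'.baseChange K).kummerClassOver (κ.layerSubgroup k ⊓ decomp 𝔭) 3 Q hQ ≠ 0) →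
      ∃ (Dat : (W'.baseChange K).LambdaAdicSelmerData κ γ) (z : Dat.S),
        IsLambdaAdicHeegnerClass Dat F α z ∧
        Summit.BirchSwinnertonDyer.BirchSwinnertonDyer.Theorems.UniversalToricDescentTwinHowardConclusion.Stmt.conclusionAtControlLevels 3 N' W' K κ γ
          hγ.out (baseChange_noPTorsion_of_surjective W' 3 hsurj K hK) Dat z := by
  intro W' _ _ N' _ K _ _ hm htr hsurj hN hK hH hodd κ hκ γ hγ 𝔭 h𝔭 he hf jbar F α hα hcoh hK1
  haveI : (W'.baseChange K).IsElliptic := by rw [WeierstrassCurve.baseChange]; infer_instance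
  -- E1: the `Λ`-adic Selmer datum (Perrin-Riou) and the `Λ`-adic Heegner class of `F` (Bertolini–Darmon / Castella (2.2))
  obtain ⟨Dat⟩ := WeierstrassCurve.LambdaAdicSelmerDataExists.nonempty_lambdaAdicSelmerData (W'.baseChange K) 3 κ hγ.out
  obtain ⟨z, hz⟩ := exists_isLambdaAdicHeegnerClass Dat F hα hcoh
  -- K1 at precision `3 = 3^1` + E6: `z ∉ 3𝔖`, in particular `z ≠ 0`
  have hK1' : ∃ k : ℕ, ∀ (Q : geomPoints (W'.baseChange K))
      (hQ : ∀ σ ∈ κ.layerSubgroup k ⊓ decomp 𝔭, σ • ((((3 : ℕ) : ℤ) ^ 1) • Q) = (((3 : ℕ) : ℤ) ^ 1) • Q),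
      (((3 : ℕ) : ℤ) ^ 1) • Q = F.z k →
        (W'.baseChange K).kummerClassOver (κ.layerSubgroup k ⊓ decomp 𝔭) (((3 : ℕ) : ℤ) ^ 1) Q hQ ≠ 0 := by
    have e31 : (((3 : ℕ) : ℤ) ^ 1) = 3 := by norm_num
    rw [e31]
    exact hK1
  have hz3 := not_exists_eq_natCast_smul_of_layerIndivisible Dat F hα hz (decomp 𝔭) hK1'
  have hz0 : z ≠ 0 := by
    intro hz0
    refine hz3 ⟨0, ?_⟩
    rw [hz0, smul_zero]
  refine ⟨Dat, z, hz, ?_⟩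
  -- the units guard of F-161′: `3` splits in `K` (Heegner, `3 ∣ N′`) ⟹ `d_K ≠ −3`; with `d_K` odd, `d_K < −4`, so `#𝓞_K^× = 2`
  have h3N : (3 : ℕ) ∣ N' := hN ▸ dvd_conductorNorm_of_mult hm
  have hsplit : ((Ideal.span {((3 : ℕ) : ℤ)}).primesOver (𝓞 K)).ncard = 2 := hH 3 Nat.prime_three h3N
  have hj : jacobiSym (NumberField.discr K) 3 = 1 :=
    (Literature.NumberTheory.QuadraticFields.Quadratic.ncard_primesOver_eq_two_iff_jacobiSym hK.1 Nat.prime_three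
      (by norm_num)).mp hsplit
  have hd3 : NumberField.discr K ≠ -3 := by
    intro h; rw [h] at hj; revert hj; norm_num [jacobiSym.mod_left]
  have hd4 : NumberField.discr K < -4 := by
    have hgt : 2 < |NumberField.discr K| := NumberField.abs_discr_gt_two (by rw [hK.1]; exact one_lt_two)
    have hneg : NumberField.discr K < 0 := hK.discr_neg
    rw [abs_of_neg hneg] at hgt
    obtain ⟨r, hr⟩ := hodd
    omega
  have hu : ¬ 3 ∣ Nat.card (𝓞 K)ˣ := by
    rw [Literature.NumberTheory.EllipticCurves.card_units_eq_two_of_discr_lt hK hd4]; norm_num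
  -- K2a′ (KS-twin) + the twin's `SatisfiesH` (PROVED) + `LargePrimes` (generic) + K2a″ (Thm. 1.6.1′): x9's D1 chain on the twin frame
  obtain ⟨S, hpS, hbad, hSN, hSσ, m₁, hKSm⟩ :=
    ksTwin_of_ksTwinLambda hK2 W' N' K hm htr hsurj hN hK hH hodd κ hκ γ jbar F α hα hcoh Dat z hz hz0
  obtain ⟨m₀, hHyp⟩ := UniversalToricDescentTwinSatisfiesHAtThree.exists_satisfiesH_levelsTame_of_mult_three N' W' K κ hm hsurj
    hK hH hκ S hpS hbad hSN hSσ
  refine ⟨max m₀ m₁, fun m hm1 hle ↦ ?_⟩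
  have hle₀ : m₀ ≤ m := le_trans (le_max_left _ _) hle
  have hle₁ : m₁ ≤ m := le_trans (le_max_right _ _) hle
  letI := IwasawaAlgebra.isDomain_quotient_X_pow_add_C 3 hm1
  letI := IwasawaAlgebra.isDiscreteValuationRing_quotient_X_pow_add_C 3 hm1
  haveI := IwasawaAlgebra.EisensteinCoeff.isLocalRing_succ 3 hm1
  letI := IwasawaAlgebra.EisensteinCoeff.algebraOfSpecSucc 3 m
  haveI := W'.isScalarTower_algebraOfSpecSucc (K := K) (p := 3) (m := m)
  letI := W'.residueModuleSucc (K := K) (p := 3) hm1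
  obtain ⟨π, L, hL, hLS, s₁, hsub, t, ht, I, jbar', hKS'⟩ := hKSm m hm1 hle₁
  obtain ⟨c₀, σ, hσ₁, hσ, hτl, hτ₂, Dd, hy⟩ := hHyp m hm1 hle₀ π L hL hLS jbar'
  obtain ⟨κKS, hone, hlink⟩ := hKS' _ Dd hy
  have hLP := W'.eisensteinDVRSetting_largePrimes (κ.unitTwist (-1)) hm1 S hpS hbad L hL hLS jbar' _ Dd
    (W'.eisensteinLevelsTameFs (κ.unitTwist (-1)) hm1 π S hpS hbad L hL hLS) hsub
  -- the characteristic guard of F-161′: `3 ≠ 0` in `S_m = Λ/(T^m + 3)` (`q_m ∤ 3`)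
  have hp0 : ((3 : ℕ) : IwasawaAlgebra 3 ⧸
      Ideal.span {(PowerSeries.X ^ m + PowerSeries.C ((3 : ℕ) : ℤ_[3]) : IwasawaAlgebra 3)}) ≠ 0 := by
    rw [← map_natCast (Ideal.Quotient.mk _), Ne, Ideal.Quotient.eq_zero_iff_mem, Ideal.mem_span_singleton,
      ← map_natCast (PowerSeries.C (R := ℤ_[3]))]
    exact IwasawaAlgebra.not_X_pow_add_C_dvd_C_natCast 3 hm1
  have hconc := Summit.BirchSwinnertonDyer.BirchSwinnertonDyer.Cruxes.TwinAlgMuZeroAtThree.BetaRoad.stub_thm161 3 K _ _ _ _ _ _ κKS hy hp0 hu hLP hone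
  have hone_eq : κKS.one = fun k ↦ I.proj (k + 1) (Dat.toEisensteinH1Linear hm1 t ht I hγ.out
      (baseChange_noPTorsion_of_surjective W' 3 hsurj K hK) z) := funext hlink
  rw [hone_eq] at hconc
  exact ⟨S, hpS, hbad, hSN, hSσ, L, hL, hLS, jbar', _, Dd,
    W'.eisensteinLevelsTameFs (κ.unitTwist (-1)) hm1 π S hpS hbad L hL hLS, t, ht, I, hy, hconc⟩

/-- **K2_res from K1 + K2a‴** (residual corank ≤ 1 up the tower, uniformly): K1 ⟹ `(proj_k 𝐳_∞)_1 ≠ 0` ⟹ bounded index of the control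
images; with Howard's conclusion ⟹ `#(X_tors/q_m) ≤ 3^{C′}` uniformly ⟹ `μ(X_tors) = 0`, `rank_Λ X ≤ 1`; then the residual bound
(`…TwinK2ResOfConclusion.twin_k2Res_of_conclusion_of_layerIndivisible`, p766849).
[cite: Howard2004HeegnerKolyvagin, Thm. 1.6.1, Thm. B, proof of Thm. 2.2.10] [cite: GreenbergLNM1716, §1 (PDF pp. 60–62)] -/
theorem residualCorankLeOneMult_of_ksTwinLambda (hK2 : UniversalToricDescentKsTwinLambdaDefs.KsTwinLambdaAdicAtThree)
    (W' : WeierstrassCurve ℚ) [W'.IsElliptic] [W'.IsGloballyMinimal] (N' : ℕ) [NeZero N']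
    (K : Type) [Field K] [NumberField K]
    (hm : Rank1Residual.Mult W' 3) (htr : ¬ 3 ∣ padicValInt 3 W'.minimalDiscriminantInt)
    (hsurj : W'.HasSurjectiveModNGaloisRep 3) (hN : W'.conductorNorm ℤ = N') (hK : IsImaginaryQuadratic K)
    (hH : SatisfiesHeegnerHypothesis N' K) (hodd : Odd (NumberField.discr K))
    (κ : ZpExtension K 3) (hκ : κ.IsAnticyclotomic)
    (γ : absoluteGaloisGroup K) [hγ : Fact (κ.IsTopGenerator γ)]
    (𝔭 : HeightOneSpectrum (𝓞 K)) (h𝔭 : ((3 : ℕ) : 𝓞 K) ∈ 𝔭.asIdeal)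
    (he : 𝔭.asIdeal.ramificationIdx (𝓞 ℚ) = 1) (hf : 𝔭.asIdeal.inertiaDeg (𝓞 ℚ) = 1)
    (jbar : AlgebraicClosure K →+* ℂ) (F : HeegnerFamily N' W' K κ jbar) (α : ℤ)
    (hα : α ^ 2 = 1) (hcoh : F.IsNormCompatible γ α)
    (hK1 : ∃ k : ℕ, ∀ (Q : geomPoints (W'.baseChange K))
      (hQ : ∀ σ ∈ κ.layerSubgroup k ⊓ decomp 𝔭, σ • ((3 : ℤ) • Q) = (3 : ℤ) • Q),
      (3 : ℤ) • Q = F.z k →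
        (W'.baseChange K).kummerClassOver (κ.layerSubgroup k ⊓ decomp 𝔭) 3 Q hQ ≠ 0) :
    ∃ C : ℕ, ∀ n : ℕ,
      Nat.card {s : (W'.baseChange K).selmerInfty κ |
        3 • s = 0 ∧ (W'.baseChange K).conjH1 3 κ.kerSubgroup (γ ^ 3 ^ n)
          (s : (W'.baseChange K).subgroupH1 3 κ.kerSubgroup) = s} ≤ 3 ^ (3 ^ n + C) := by
  -- K2a: the `Λ`-adic datum, the Heegner class and Howard's conclusion at its control levels
  obtain ⟨Dat, z, hz, hconc⟩ :=
    howardConclusionOfFamily_of_ksTwinLambda hK2 W' N' K hm htr hsurj hN hK hH hodd κ hκ γ 𝔭 h𝔭 he hf jbar F α hα hcoh hK1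
  -- K1 at precision `3 = 3^1`
  have hK1' : ∃ k : ℕ, ∀ (Q : geomPoints (W'.baseChange K))
      (hQ : ∀ σ ∈ κ.layerSubgroup k ⊓ decomp 𝔭, σ • ((((3 : ℕ) : ℤ) ^ 1) • Q) = (((3 : ℕ) : ℤ) ^ 1) • Q),
      (((3 : ℕ) : ℤ) ^ 1) • Q = F.z k →
        (W'.baseChange K).kummerClassOver (κ.layerSubgroup k ⊓ decomp 𝔭) (((3 : ℕ) : ℤ) ^ 1) Q hQ ≠ 0 := by
    have e31 : (((3 : ℕ) : ℤ) ^ 1) = 3 := by norm_num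
    rw [e31]
    exact hK1
  exact Summit.BirchSwinnertonDyer.BirchSwinnertonDyer.Theorems.UniversalToricDescentTwinK2ResOfConclusion.twin_k2Res_of_conclusion_of_layerIndivisible
    W' N' K hm hsurj hK hH κ hκ γ F hα Dat hz (decomp 𝔭) hK1' hconc

/-! ## 4. Bucket B of the crux -/

/-- **Bucket B of crux 24737 `TwinAlgMuZeroAtThree` from K1″ and K2a‴ BY NAME** (the composition of line `beta-road`, v16): for a twin
`W′/ℚ` multiplicative and très ramifié at `3` with `ρ̄₃` onto and conductor `N′`, `K` imaginary quadratic Heegner for `N′` with odd `d_K`,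
`κ` anticyclotomic with topological generator `γ`, `𝔭 ∋ 3` of degree one and `𝔭′ ∋ 3`, `𝔭′ ≠ 𝔭`: `X_(∅,0)(E′/K_∞)` at `𝔭′` is
`Λ`-torsion and its characteristic ideal in `R₀⟦T⟧` has a generator with a coefficient of `3`-adic norm `1` (algebraic `μ = 0`).
Chain: K1(𝔭) · degree one of `𝔭′` (`degreeOne_of_dvd_of_heegner`, `3 ∣ N′`) · K1(𝔭′) · K2_res · P_res (`stub_residualLinkMult`, landed
p745706) · the receptacle `isTorsion_and_exists_generator_of_finite_pTorsion`.  CONDITIONAL on the two research constants; the crux's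
C₀ bucket is not addressed. [cite: Howard2004HeegnerKolyvagin, Thm. B, Thm. 2.3.1] [cite: GreenbergLNM1716, §1] -/
theorem twinAlgMuZeroAtThree_mult_of_betaRoad
    (hK1 : UniversalToricDescentPrincipalHeegnerIndivisibleDefs.PrincipalHeegnerIndivisibleMultAtThree)
    (hK2 : UniversalToricDescentKsTwinLambdaDefs.KsTwinLambdaAdicAtThree)
    (W' : WeierstrassCurve ℚ) [W'.IsElliptic] [W'.IsGloballyMinimal] (N' : ℕ) [NeZero N']
    (K : Type) [Field K] [NumberField K]
    (hm : Rank1Residual.Mult W' 3) (htr : ¬ 3 ∣ padicValInt 3 W'.minimalDiscriminantInt)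
    (hsurj : W'.HasSurjectiveModNGaloisRep 3) (hN : W'.conductorNorm ℤ = N') (hK : IsImaginaryQuadratic K)
    (hH : SatisfiesHeegnerHypothesis N' K) (hodd : Odd (NumberField.discr K))
    (κ : ZpExtension K 3) (hκ : κ.IsAnticyclotomic)
    (γ : absoluteGaloisGroup K) [hγ : Fact (κ.IsTopGenerator γ)]
    (𝔭 : HeightOneSpectrum (𝓞 K)) (h𝔭 : ((3 : ℕ) : 𝓞 K) ∈ 𝔭.asIdeal)
    (he : 𝔭.asIdeal.ramificationIdx (𝓞 ℚ) = 1) (hf : 𝔭.asIdeal.inertiaDeg (𝓞 ℚ) = 1)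
    (𝔭' : HeightOneSpectrum (𝓞 K)) (h𝔭' : ((3 : ℕ) : 𝓞 K) ∈ 𝔭'.asIdeal) (hne : 𝔭' ≠ 𝔭) :
    Module.IsTorsion (IwasawaAlgebra 3) (XAc (W'.baseChange K) 3 κ 𝔭' ∅ γ) ∧
      ∃ g' : UnrSeries 3,
        (XAc.charIdeal (W'.baseChange K) 3 κ 𝔭' ∅ γ).map (PowerSeries.map (Halves.toUnr 3)) =
            Ideal.span {g'} ∧
          ∃ i : ℕ, ‖((PowerSeries.coeff i g' : unrIntegers 3) : ℂ_[3])‖ = 1 := by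
  -- K1 at `𝔭` (from K1″)
  obtain ⟨jbar, F, α, hα, hcoh, k, hk⟩ :=
    coherentBetaMult_of_principalIndivisible hK1 W' N' K hm htr hsurj hN hK hH hodd κ hκ γ 𝔭 h𝔭 he hf
  -- `𝔭′` is of degree one: `3 ∣ N′` (multiplicative) and `K` is Heegner for `N′`
  have h3N : (3 : ℕ) ∣ N' := hN ▸ dvd_conductorNorm_of_mult hm
  obtain ⟨he', hf'⟩ := degreeOne_of_dvd_of_heegner (p := 3) hK hH h3N h𝔭'
  -- K1 at `𝔭′` (from K1″)
  obtain ⟨jbar', F', α', hα', hcoh', k', hk'⟩ :=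
    coherentBetaMult_of_principalIndivisible hK1 W' N' K hm htr hsurj hN hK hH hodd κ hκ γ 𝔭' h𝔭' he' hf'
  -- K2_res
  obtain ⟨C, hC⟩ := residualCorankLeOneMult_of_ksTwinLambda hK2 W' N' K hm htr hsurj hN hK hH hodd κ hκ γ 𝔭 h𝔭 he hf
    jbar F α hα hcoh ⟨k, hk⟩
  -- P_res: the residual two-sided link
  have hfin : Set.Finite {s : selmerAc (W'.baseChange K) 3 κ 𝔭' ∅ | 3 • s = 0} :=
    Summit.BirchSwinnertonDyer.BirchSwinnertonDyer.Cruxes.TwinAlgMuZeroAtThree.BetaRoad.stub_residualLinkMult W' N' K hm htr hsurj hN hK hH κ hκ γ 𝔭 h𝔭 he hf 𝔭' h𝔭' hne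
      jbar F α k hα hcoh hk jbar' F' α' k' hα' hcoh' hk' C hC
  -- the landed receptacle
  haveI : (W'.baseChange K).IsElliptic := by rw [WeierstrassCurve.baseChange]; infer_instance
  exact isTorsion_and_exists_generator_of_finite_pTorsion (W'.baseChange K) 3 κ 𝔭' ∅ γ Set.finite_empty hfin

/-! ## 5. The crux from its three registered stubs -/

/-- **Crux 24737 `TwinAlgMuZeroAtThree` BY NAME from the three registered stubs of line `beta-road` v16** — K1″ and K2a‴ as the
Theorems constants, C₀ (`stub_goodSS`, the good-supersingular `a₃ = 0` bucket of the R2 text, VERBATIM, a different line's research)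
as an explicit hypothesis: the bucket split of the R2 text, bucket B by `twinAlgMuZeroAtThree_mult_of_betaRoad`.  CONDITIONAL (three open
hypotheses); this is the skeleton's `TwinAlgMuZeroAtThree_of` with its `sorry`s replaced by hypotheses, nothing more; 24737 stays OPEN.
[cite: Howard2004HeegnerKolyvagin, Thm. 2.3.1, Thm. B] -/
theorem twinAlgMuZeroAtThree_of_betaRoadStubs
    (hK1 : UniversalToricDescentPrincipalHeegnerIndivisibleDefs.PrincipalHeegnerIndivisibleMultAtThree)
    (hK2 : UniversalToricDescentKsTwinLambdaDefs.KsTwinLambdaAdicAtThree)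
    (hC0 :
      ∀ (W' : WeierstrassCurve ℚ) [W'.IsElliptic] [W'.IsGloballyMinimal] (N' : ℕ) [NeZero N']
        (K : Type) [Field K] [NumberField K],
        Rank1Residual.GoodSS W' 3 → W'.frobeniusTrace 3 = 0 →
        W'.HasSurjectiveModNGaloisRep 3 → W'.conductorNorm ℤ = N' → IsImaginaryQuadratic K →
        SatisfiesHeegnerHypothesis N' K → Odd (NumberField.discr K) →
        ∀ (κ : ZpExtension K 3), κ.IsAnticyclotomic →
        ∀ (γ : absoluteGaloisGroup K) [Fact (κ.IsTopGenerator γ)]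
          (𝔭 : HeightOneSpectrum (𝓞 K)), ((3 : ℕ) : 𝓞 K) ∈ 𝔭.asIdeal →
          𝔭.asIdeal.ramificationIdx (𝓞 ℚ) = 1 → 𝔭.asIdeal.inertiaDeg (𝓞 ℚ) = 1 →
        ∀ (𝔭' : HeightOneSpectrum (𝓞 K)), ((3 : ℕ) : 𝓞 K) ∈ 𝔭'.asIdeal → 𝔭' ≠ 𝔭 →
        Module.IsTorsion (IwasawaAlgebra 3) (XAc (W'.baseChange K) 3 κ 𝔭' ∅ γ) ∧
          ∃ g' : UnrSeries 3,
            (XAc.charIdeal (W'.baseChange K) 3 κ 𝔭' ∅ γ).map (PowerSeries.map (Halves.toUnr 3)) =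
                Ideal.span {g'} ∧
              ∃ i : ℕ, ‖((PowerSeries.coeff i g' : unrIntegers 3) : ℂ_[3])‖ = 1) :
    Summit.BirchSwinnertonDyer.BirchSwinnertonDyer.Theses.UniversalToricDescent.TwinAlgMuZeroAtThree := by
  intro W' _ _ N' _ K _ _ Dt' hbucket hsurj hN hK hH hodd κ hκ γ _ 𝔭 h𝔭 he hf 𝔭' h𝔭' hne
  rcases hbucket with ⟨hm, htr⟩ | ⟨hss, ha⟩
  · exact twinAlgMuZeroAtThree_mult_of_betaRoad hK1 hK2 W' N' K hm htr hsurj hN hK hH hodd κ hκ γ 𝔭 h𝔭 he hf 𝔭' h𝔭' hne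
  · exact hC0 W' N' K hss ha hsurj hN hK hH hodd κ hκ γ 𝔭 h𝔭 he hf 𝔭' h𝔭' hne

end Summit.BirchSwinnertonDyer.BirchSwinnertonDyer.Theorems.UniversalToricDescentTwinAlgMuZeroAtThreeOfBetaRoad

end
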